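import Summits.CriticalPhenomena.SAWScalingLimit.Theorems.SAWRenewalTightnessEventualTightVirginization
import Summits.CriticalPhenomena.SAWScalingLimit.Theorems.SAWRenewalTightnessEventualTightAspectReduction

/-!
# `EventualTight`, line `Sketch` v7: the bulk child `BulkShellTight` modulo the virgin-arc count atom X2c₁

Crux stmt-CriticalPhenomena-1372 (`SAWRenewalTightness.EventualTight`), line `Sketch`, registration v7 (lead c4).  The end state of
the line, composed from landed files only:

* `bulkShellTight_of_virginArcTraversalTight` — the virgin-arc count atom X2c₁ (`stub_virginArcTraversalTight`, the hypothesis,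
  verbatim its registered signature) gives the bulk child `BulkShellTight` (stmt-17588): virginization
  (`bulkShellTightAtAspectTwo_of_virginArcTraversalTight`, file `…Virginization.lean`) followed by the aspect reduction
  (`stub_aspectReduction`, file `…AspectReduction.lean`);
* the composition with the split glue `EventualTight_of_subs` (`EventualTight ⟸ E ∧ X2c₁`, E = stmt-17587) is the companion file
  `SAWRenewalTightnessEventualTightOfVirginArc.lean`.

X2c₁ is a pure lattice statement (finite discs of `ℤ²`, two doors, arbitrary exterior; `Cruxes/EventualTight/LeadAnalysis-c4.md` §2,
numerics `X2c-attack-c4.md`); it is research-grade and NOT asserted here. [cite: AizenmanBurchardDuke1999, Thm 1.1] [cite: DuminilCopinSmirnov2012, §2]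
-/

noncomputable section

open MeasureTheory Filter Topology Set Metric
open scoped ENNReal NNReal unitInterval
open Literature.Probability.RandomPlanarGeometry Literature.Probability.LatticeModels

namespace Summit.CriticalPhenomena.SAWScalingLimit.Theorems

/-- **The bulk child modulo the atom**: X2c₁ (`stub_virginArcTraversalTight`, verbatim) implies `BulkShellTight` (stmt-17588,
verbatim) — virginization at aspect two, then the aspect reduction. [folklore] -/
theorem bulkShellTight_of_virginArcTraversalTight :
    (∀ θ : ℝ, 0 < θ →
      ∃ (k : ℕ) (N₀ : ℝ), 0 < N₀ ∧
        ∀ (H : SimpleGraph (Site 2)) (Λ : Set (Site 2)) (z₀ : ℂ) (N : ℝ) (u c u' c' : Site 2),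
          N₀ ≤ N →
          (H ≤ zdGraph 2 ∧ (∀ v : Site 2, dist (Site.toComplex v) z₀ ≤ N → v ∈ Λ) ∧
            ∀ v v' : Site 2, dist (Site.toComplex v) z₀ ≤ N + 1 →
              dist (Site.toComplex v') z₀ ≤ N + 1 → (zdGraph 2).Adj v v' → H.Adj v v') →
          (H.Adj u c ∧ u ∉ Λ ∧ c ∈ Λ ∧ dist (Site.toComplex c) z₀ ≤ N ∧
            N < dist (Site.toComplex u) z₀) →
          (H.Adj u' c' ∧ u' ∉ Λ ∧ c' ∈ Λ ∧ dist (Site.toComplex c') z₀ ≤ N ∧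
            N < dist (Site.toComplex u') z₀) →
          ∑' p : {p : {p : H.Walk c c' // p.IsPath ∧ ∀ v ∈ p.support, v ∈ Λ} //
              ∃ ι κ : Fin k → Fin (p.1.support.map Site.toComplex).length, (∀ m, ι m ≤ κ m) ∧
                (∀ m, (dist ((p.1.support.map Site.toComplex).get (ι m)) z₀ ≤ 2 * N / 5 ∧
                    3 * N / 5 ≤ dist ((p.1.support.map Site.toComplex).get (κ m)) z₀) ∨
                  (3 * N / 5 ≤ dist ((p.1.support.map Site.toComplex).get (ι m)) z₀ ∧
                    dist ((p.1.support.map Site.toComplex).get (κ m)) z₀ ≤ 2 * N / 5)) ∧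
                ∀ ⦃m m'⦄, m < m' → κ m ≤ ι m'},
              ENNReal.ofReal (SAW.criticalFugacity ^ p.1.1.length) ≤
            ENNReal.ofReal θ *
              ∑' p : {p : H.Walk c c' // p.IsPath ∧ ∀ v ∈ p.support, v ∈ Λ},
                ENNReal.ofReal (SAW.criticalFugacity ^ p.1.length)) →
    ∀ (D : DobrushinDomain) (a b : ℝ → Site 2), SAW.IsEndpointApprox D a b →
      ∀ (y : ℂ) (η R : ℝ), 0 < η → η < R → Metric.closedBall y (2 * R) ⊆ D.carrier →
        ∀ ε : ℝ, 0 < ε → ∃ (j : ℕ) (δ₁ : ℝ), 0 < δ₁ ∧ ∀ δ ∈ Set.Ioc (0 : ℝ) δ₁,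
          SAW.law D.carrier δ (a δ) (b δ)
            {γ | (⟨γ.walk.toCurve (meshPoint δ)⟩ : Curve ℂ).HasTraversals j y η R} ≤ ENNReal.ofReal ε :=
  fun hX => stub_aspectReduction (bulkShellTightAtAspectTwo_of_virginArcTraversalTight hX)

end Summit.CriticalPhenomena.SAWScalingLimit.Theorems

end
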